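import Literature.Analysis.Calculus.FixedPointSmoothDependence
import Mathlib.Analysis.InnerProductSpace.PiL2
import HarnessLib

/-!
# S2β · LAPLACE row — (IFT-min): A CONTINUOUS FAMILY OF NON-DEGENERATE CRITICAL POINTS IS AS SMOOTH AS THE FUNCTION (pen w5-20520 g14)

Cell `ym3-torus` (rung R3: continuum `SU(2)` Yang–Mills on `T³` — NOT `d = 4`, NOT infinite volume, NOT a mass gap, NOT Clay); width seat `ym-ust-20520-w5` g14;
helper of the crux `stmt-QuantumFields-20520` (`--supports`, NOT a proof of it).  THEOREMS ONLY (0 `def`, 0 `sorry`; default heartbeats); generic calculus.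

WHY (FOUR-POINT-DECAY, LINE g18-1 v9.1; w4-20520 g15's LOCATE-DECAY §3 (BRD) «C¹ minimiser family `U₀(s,t)` … IFT at the non-degenerate orbit», and the common-tube
rectangle of w5's LOCATE 20:38Z: `M(s,t) = Hess_y A(c.Φ(x(s,t), σ_U y))` at the transversal coordinate `y(s,t)` of the moving minimiser).  Both need: if `f : S × E → ℝ` is
`C^{n+1}` near `(0, y 0)`, `s ↦ y s` is a CONTINUOUS family of critical points of `f (s, ·)`, and the `y`-Hessian at `(0, y 0)` is invertible, then `y` is `C^n` at `0`
(and so is the Hessian along it).  This file is that brick, over lit ✓`FixedPointSmoothDependence.contDiffAt_of_implicitZero'` applied to the partial differential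
`Φ(s, e) := D₂f(s, e) = (fderiv f (s,e)) ∘ inr`.

WHAT.  §1 `partialFDeriv` letters: `(fderiv f (s,e)) ∘L inr = fderiv (f (s,·)) e` where `f` is differentiable; the map `q ↦ (fderiv f q) ∘L inr` is `C^n` at a point where
`f` is `C^{n+1}`.  §2 ★★★ `contDiffAt_of_criticalFamily`.  §3 ★ `isInvertible_of_forall_pos` — on a finite-dimensional space a continuous bilinear form
`B : E →L (E →L ℝ)` with `0 < B v v` for `v ≠ 0` is invertible (injective ⇒ bijective by `finrank (E →L[ℝ] ℝ) = finrank E`): the shape in which GAP♯ ∘ (T2)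
(uniform quadratic growth along the transversal ⇒ positive-definite Hessian, ✓`…S2BetaLaplacePeano`) delivers the non-degeneracy.

HONEST SCOPE.  Generic calculus; proves no stub; FOUR-POINT-DECAY ∕ LAPLACE ∕ S2β ∕ the crux 20520 NOT proved; `YM3TorusSU2` NOT proved; the Yang–Mills mass gap (Clay) NOT proved.

References: [Dieudonne1960] Ch. X §2 (10.2.1)–(10.2.3); [Balaban1985Variational] CMP 102 (1985) Thm 1 (8)–(10) p. 279 and (142) p. 299.
-/

noncomputable section

open scoped Topology ContDiff
open Filter Set Function
open Literature.Analysis.Calculus (contDiffAt_of_implicitZero')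

namespace Summit.QuantumFields.YangMills.Theorems.FluctuationComparisonRegPrIntLS2BetaCriticalFamily

variable {S E : Type*} [NormedAddCommGroup S] [NormedSpace ℝ S] [NormedAddCommGroup E] [NormedSpace ℝ E]

/-! ## §1 The partial differential in the second variable -/

/-- At a point of differentiability, the partial differential `(Df(s,e)) ∘ inr` IS the differential of the slice `f (s, ·)` at `e`. [folklore] -/
theorem fderiv_slice_eq_comp_inr {F : Type*} [NormedAddCommGroup F] [NormedSpace ℝ F] {f : S × E → F} {s : S} {e : E}
    (hf : DifferentiableAt ℝ f (s, e)) :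
    fderiv ℝ (fun e' => f (s, e')) e = (fderiv ℝ f (s, e)).comp (ContinuousLinearMap.inr ℝ S E) :=
  (hf.hasFDerivAt.comp e (hasFDerivAt_prodMk_right s e)).fderiv

/-- The partial differential `q ↦ (Df q) ∘ inr` is `C^n` at a point where `f` is `C^{n+1}`. [cite: Dieudonne1960, Ch. X §2 (10.2.1) (bookkeeping)] -/
theorem contDiffAt_partialFDeriv {F : Type*} [NormedAddCommGroup F] [NormedSpace ℝ F] {f : S × E → F} {q₀ : S × E} {n : WithTop ℕ∞}
    (hf : ContDiffAt ℝ (n + 1) f q₀) :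
    ContDiffAt ℝ n (fun q : S × E => (fderiv ℝ f q).comp (ContinuousLinearMap.inr ℝ S E)) q₀ := by
  have h1 : ContDiffAt ℝ n (fderiv ℝ f) q₀ := hf.fderiv_right le_rfl
  have h2 : ContDiff ℝ n (fun L : S × E →L[ℝ] F => L.comp (ContinuousLinearMap.inr ℝ S E)) := by
    have h := ((isBoundedBilinearMap_comp (𝕜 := ℝ) (E := E) (F := S × E) (G := F)).contDiff (n := n)).comp
      ((contDiff_id (𝕜 := ℝ) (E := S × E →L[ℝ] F)).prodMk (contDiff_const (c := ContinuousLinearMap.inr ℝ S E)))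
    exact h
  exact h2.contDiffAt.comp q₀ h1

/-! ## §2 A continuous family of non-degenerate critical points is smooth -/

/-- ★★★ **(IFT-min) A CONTINUOUS FAMILY OF NON-DEGENERATE CRITICAL POINTS IS `C^n`.**  Let `f : S × E → ℝ` be `C^{n+1}` at `(0, y 0)` (`n ≠ 0`; `S, E` real Banach),
let `s ↦ y s` be continuous at `0` with `D(f(s,·))(y s) = 0` for `s` near `0`, and let the second partial differential at `(0, y 0)` —
`(D[q ↦ Df(q) ∘ inr](0, y 0)) ∘ inr : E →L (E →L ℝ)` — be invertible.  Then `y` is `C^n` at `0`.  (lit ✓`contDiffAt_of_implicitZero'` with `Φ := (s,e) ↦ Df(s,e) ∘ inr`,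
which near `(0, y 0)` is the slice differential, so `Φ(s, y s) = 0 = Φ(0, y 0)`.) [cite: Dieudonne1960, Ch. X §2 (10.2.1)–(10.2.3)] [cite: Balaban1985Variational, Thm 1 (8) p.279] -/
theorem contDiffAt_of_criticalFamily [CompleteSpace S] [CompleteSpace E] {f : S × E → ℝ} {y : S → E} {n : WithTop ℕ∞} (hn : n ≠ 0)
    (hf : ContDiffAt ℝ (n + 1) f (0, y 0))
    (hcrit : ∀ᶠ s in 𝓝 (0 : S), fderiv ℝ (fun e => f (s, e)) (y s) = 0)
    (hy : ContinuousAt y 0)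
    (hH : ((fderiv ℝ (fun q : S × E => (fderiv ℝ f q).comp (ContinuousLinearMap.inr ℝ S E)) (0, y 0)).comp
      (ContinuousLinearMap.inr ℝ S E)).IsInvertible) :
    ContDiffAt ℝ n y 0 := by
  have hΦ : ContDiffAt ℝ n (fun q : S × E => (fderiv ℝ f q).comp (ContinuousLinearMap.inr ℝ S E)) (0, y 0) := contDiffAt_partialFDeriv hf
  -- `f` is differentiable near `(0, y 0)`, and `(s, y s) → (0, y 0)`
  have h1 : (1 : WithTop ℕ∞) ≤ n + 1 := le_add_self
  have hdiff : ∀ᶠ q in 𝓝 ((0 : S), y 0), DifferentiableAt ℝ f q :=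
    ((hf.of_le h1).eventually (by simp)).mono fun q hq => hq.differentiableAt one_ne_zero
  have htend : Tendsto (fun s => ((s : S), y s)) (𝓝 0) (𝓝 (0, y 0)) := tendsto_id.prodMk_nhds hy.tendsto
  have hzero : ∀ᶠ s in 𝓝 (0 : S), (fderiv ℝ f (s, y s)).comp (ContinuousLinearMap.inr ℝ S E) =
      (fderiv ℝ f (0, y 0)).comp (ContinuousLinearMap.inr ℝ S E) := by
    have h0 : (fderiv ℝ f (0, y 0)).comp (ContinuousLinearMap.inr ℝ S E) = 0 := by
      rw [← fderiv_slice_eq_comp_inr (hf.differentiableAt (by simp))]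
      exact hcrit.self_of_nhds
    rw [h0]
    filter_upwards [hcrit, htend.eventually hdiff] with s hs hds
    rw [← fderiv_slice_eq_comp_inr hds, hs]
  exact contDiffAt_of_implicitZero' hn hΦ hH hzero hy

/-- **… AND THE SLICE HESSIAN ALONG THE FAMILY IS `C^{n−1}`-REGULAR IN THE SENSE OF `C^n` DATA**: the map `s ↦ D[q ↦ Df(q) ∘ inr](s, y s)` (whose `∘ inr` part is the
slice Hessian at the moving critical point) is `C^{n'}` at `0` whenever `n' + 1 ≤ n` — composition of the `C^{n'}`-map `q ↦ D(D₂f)(q)` with the `C^n` curve `s ↦ (s, y s)`.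
[cite: Dieudonne1960, Ch. X §2 (10.2.3)] -/
theorem contDiffAt_hessian_along [CompleteSpace S] [CompleteSpace E] {f : S × E → ℝ} {y : S → E} {n n' : WithTop ℕ∞} (hn : n ≠ 0) (hn' : n' + 1 ≤ n)
    (hf : ContDiffAt ℝ (n + 1) f (0, y 0))
    (hcrit : ∀ᶠ s in 𝓝 (0 : S), fderiv ℝ (fun e => f (s, e)) (y s) = 0)
    (hy : ContinuousAt y 0)
    (hH : ((fderiv ℝ (fun q : S × E => (fderiv ℝ f q).comp (ContinuousLinearMap.inr ℝ S E)) (0, y 0)).comp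
      (ContinuousLinearMap.inr ℝ S E)).IsInvertible) :
    ContDiffAt ℝ n' (fun s : S => fderiv ℝ (fun q : S × E => (fderiv ℝ f q).comp (ContinuousLinearMap.inr ℝ S E)) (s, y s)) 0 := by
  have hys : ContDiffAt ℝ n y 0 := contDiffAt_of_criticalFamily hn hf hcrit hy hH
  have hΦ : ContDiffAt ℝ n (fun q : S × E => (fderiv ℝ f q).comp (ContinuousLinearMap.inr ℝ S E)) (0, y 0) := contDiffAt_partialFDeriv hf
  have hDΦ : ContDiffAt ℝ n' (fderiv ℝ (fun q : S × E => (fderiv ℝ f q).comp (ContinuousLinearMap.inr ℝ S E))) (0, y 0) := hΦ.fderiv_right hn'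
  have hpair : ContDiffAt ℝ n' (fun s : S => ((s : S), y s)) 0 := (contDiffAt_id.prodMk hys).of_le (le_trans le_self_add hn')
  exact hDΦ.comp 0 hpair

/-! ## §3 Non-degeneracy from positivity (finite dimension) -/

/-- ★ **A POSITIVE-DEFINITE CONTINUOUS BILINEAR FORM ON A FINITE-DIMENSIONAL SPACE IS INVERTIBLE** as a map `E →L (E →L ℝ)`: it is injective (`B v = 0 ⇒ B v v = 0 ⇒ v = 0`)
between spaces of the same finite dimension. (The shape in which «uniform quadratic growth along the transversal ⇒ `0 < Hess v v`» delivers the hypothesis `hH` of §2.)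
[cite: Balaban1985Variational, (142) p.299 (bookkeeping)] -/
theorem isInvertible_of_forall_pos [FiniteDimensional ℝ E] (B : E →L[ℝ] (E →L[ℝ] ℝ)) (hpos : ∀ v : E, v ≠ 0 → 0 < B v v) :
    B.IsInvertible := by
  have hinj : Function.Injective B := by
    intro v w hvw
    by_contra hne
    have hne' : v - w ≠ 0 := sub_ne_zero.2 hne
    have hp := hpos (v - w) hne'
    have hB0 : B (v - w) = 0 := by rw [map_sub, hvw, sub_self]
    have hzero : B (v - w) (v - w) = 0 := by rw [hB0]; rfl
    exact (lt_irrefl (0 : ℝ)) (hzero ▸ hp)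
  -- same finite dimension: `E →L[ℝ] ℝ ≃ E →ₗ[ℝ] ℝ` has `finrank = finrank E`
  have hdim : Module.finrank ℝ (E →L[ℝ] ℝ) = Module.finrank ℝ E :=
    (LinearEquiv.finrank_eq (LinearMap.toContinuousLinearMap : (E →ₗ[ℝ] ℝ) ≃ₗ[ℝ] (E →L[ℝ] ℝ))).symm.trans
      (Subspace.dual_finrank_eq (K := ℝ) (V := E))
  have hbij : Function.Bijective (B : E →ₗ[ℝ] (E →L[ℝ] ℝ)) := by
    refine ⟨hinj, ?_⟩
    haveI : FiniteDimensional ℝ (E →L[ℝ] ℝ) :=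
      Module.Finite.equiv (LinearMap.toContinuousLinearMap : (E →ₗ[ℝ] ℝ) ≃ₗ[ℝ] (E →L[ℝ] ℝ))
    exact (LinearMap.injective_iff_surjective_of_finrank_eq_finrank hdim.symm).1 hinj
  let e : E ≃ₗ[ℝ] (E →L[ℝ] ℝ) := LinearEquiv.ofBijective (B : E →ₗ[ℝ] (E →L[ℝ] ℝ)) hbij
  refine ⟨e.toContinuousLinearEquiv, ?_⟩
  ext v w
  rfl

end Summit.QuantumFields.YangMills.Theorems.FluctuationComparisonRegPrIntLS2BetaCriticalFamily

end
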